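import Summits.HodgeConjecture.HodgeConjecture.Theses.RankFourFaces
import Summits.HodgeConjecture.HodgeConjecture.Theses.ConservativityLefschetz
import Summits.HodgeConjecture.HodgeConjecture.Theorems.PadicSemiregularLiftHodgeBeyondAnchorsMotivatedSplit
import Literature.AlgebraicGeometry.Motives.AbelianVarietyProjectiveChart

/-!
# Line `abelian-domination` for the crux `AbelianComplement` (RankFourFaces stmt-HodgeConjecture-15889; unit key /
ConservativityLefschetz stmt-HodgeConjecture-10452) — the BC2-redirect decomposition, registered as a skeleton

Crux-strategist planner-cstrat-stmt-HodgeConjecture-10452-q1-0, 2026-08-17. The crux is kernel-checked EQUIVALENT to the summit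
with no hypothesis (`Theorems/AbelianComplement/Negative/RankFourFacesSummitEquivalence.lean`), so every line for it is a line
for the Hodge conjecture; this one is the factorisation that keeps route `RankFourFaces`' own chain load-bearing:

  HC  ⟸  (1) HC for every complex abelian variety                      — `stub_hodgeAbelianVarieties`  (= stmt-1333 verbatim;
                                                                           in RankFourFaces the OUTPUT of cruxes 2–4)
       ∧  (2) ABELIAN DOMINATION of deep-middle Hodge classes              — `stub_abelianDomination`      (NEW, conjecture-grade)
       ∧  (3) diagonal pull-back preserves `Nᵖ H²ᵖ` (Voisin II 9.21 (i))  — `stub_diagonalPullbackAlgebraic` (= stmt-17490 verbatim;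
                                                                           theorem in print)

Composition `AbelianComplement_of` (RankFourFaces decl) and `AbelianComplementCL_of` (ConservativityLefschetz decl, the unit's
keyed item) are sorry-free; the mathematics is `Cruxes/AbelianComplement/SplitGlue.lean` (same proof, inlined here so that the
skeleton imports no Cruxes module). Card: `Lines/abelian_domination.md`. The `route edit --split` that would file (1)–(3) as
children is refused to this seat (final-cycle rule); door: `Cruxes/AbelianComplement/SPLIT-DOOR.md`.
-/

set_option linter.dupNamespace false

noncomputable section

open CategoryTheory AlgebraicGeometry MonoidalCategory CartesianMonoidalCategory
open Literature.AlgebraicTopology.SingularHomology Literature.Geometry.Kaehler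
open Literature.AlgebraicGeometry.Motives Literature.AlgebraicGeometry.HodgeTheory
open Summit.HodgeConjecture.HodgeConjecture.Theorems.HodgeBeyondAnchors

namespace Summit.HodgeConjecture.HodgeConjecture.Cruxes.AbelianComplement.AbelianDomination

/-! ## The three stub statements (verbatim the prepared children.json) -/

/-- (1) HC for every complex abelian variety — verbatim stmt-HodgeConjecture-1333. -/
def HodgeAbelianVarieties : Prop :=
  ∀ A : AbelianVariety ℂ, HodgeConjectureFor A.dim A.X

/-- (2) Abelian domination of deep-middle Hodge classes (NEW). -/
def AbelianDomination : Prop :=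
  ∀ ⦃n : ℕ⦄ ⦃X : SchemeOver ℂ⦄, IsSmoothProjective n X →
    ∀ p : ℕ, 2 ≤ p → 2 * p ≤ n →
      ∀ c : complexBetti X (2 * p), IsRationalClass c → IsOfHodgeType n X (2 * p) p p c →
        ∃ (A : AbelianVariety ℂ) (q : ℕ) (c' : complexBetti A.X (2 * q))
          (T : complexBetti A.X (2 * q) →ₗ[ℂ] complexBetti X (2 * p)),
          IsRationalClass c' ∧ IsOfHodgeType A.dim A.X (2 * q) q q c' ∧
            IsAlgebraicCorrespondence n A.dim X A.X T ∧ T c' = c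

/-- (3) Diagonal pull-back preserves `Nᵖ H²ᵖ` — verbatim stmt-HodgeConjecture-17490. -/
def DiagonalPullbackAlgebraic : Prop :=
  ∀ ⦃d : ℕ⦄ ⦃V : SchemeOver ℂ⦄, IsSmoothProjective d V → ∀ (p : ℕ)
    ⦃c : complexBetti (V ⊗ V) (2 * p)⦄, c ∈ algebraicClasses (V ⊗ V) p →
      complexBetti.map (lift (𝟙 V) (𝟙 V)) (2 * p) c ∈ algebraicClasses V p

/-! ## Registered stubs -/

/-- STUB (1), conjecture-grade (open; the milestone of route RankFourFaces, = crux rank 4 of PadicSemiregularLift):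
the Hodge conjecture for every complex abelian variety. In RankFourFaces it is SUPPLIED by the ranked chain
`CMToAbelian (FaceReduction RankFourWeilTransport)` (`hodgeAbelianVarieties_of_chain` below).
[cite: Deligne1982HodgeCycles, Thm 2.11] [cite: Andre1992HodgeCM, main theorem] -/
theorem stub_hodgeAbelianVarieties : HodgeAbelianVarieties := by
  sorry

/-- STUB (2), conjecture-grade (open off abelian-type motives; a consequence of HC; true on abelian varieties, on
varieties dominated by products of curves and wherever Kuga–Satake is algebraic): abelian domination of deep-middle
Hodge classes. [cite: Andre1996Motifs, §2.1 (p. 14)] [cite: Schoen1996DPV, main theorem (Introduction)] -/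
theorem stub_abelianDomination : AbelianDomination := by
  sorry

/-- STUB (3), provable (Voisin II Prop. 9.21 (i) + Chow's moving lemma 9.22 + Fulton §19.1 purity; landed partial range
p ≤ 1 ∨ d ≤ p + 1, p138172): diagonal pull-back preserves `Nᵖ H²ᵖ`. [cite: VoisinHodgeII2003, §9.2.4 Prop. 9.21 (i)] -/
theorem stub_diagonalPullbackAlgebraic : DiagonalPullbackAlgebraic := by
  sorry

/-! ### Name-keyed aliases (the skeleton audit admits a hypothesis of `AbelianComplement_of` iff the head constant of
its type has the short name of a declared stub) -/
namespace Registered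

/-- Alias of `HodgeAbelianVarieties` keyed by the registered stub name. -/
abbrev stub_hodgeAbelianVarieties : Prop := HodgeAbelianVarieties
/-- Alias of `AbelianDomination` keyed by the registered stub name. -/
abbrev stub_abelianDomination : Prop := AbelianDomination
/-- Alias of `DiagonalPullbackAlgebraic` keyed by the registered stub name. -/
abbrev stub_diagonalPullbackAlgebraic : Prop := DiagonalPullbackAlgebraic

end Registered

/-! ## Sorry-free composition (no `sorry` below this line) -/

/-- `(1) → (2) → (3) → HodgeConjecture` (same proof as `Cruxes/AbelianComplement/SplitGlue.lean`): Hodge models exist; reduce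
the cycle clause to the deep middle; there `c = T c' = γ^*(c')` with `γ` algebraic on `X × A` and `c'` algebraic by (1), hence
`c` algebraic by Voisin II Prop. 9.21 granted Prop. 9.20, the multiplicativity coming from (3).
[cite: VoisinHodgeII2003, §9.2.4 Prop. 9.20 and Prop. 9.21] [cite: Andre1996Motifs, §2.1 (p. 14)] -/
theorem hodgeConjecture_of (h₁ : HodgeAbelianVarieties) (h₂ : AbelianDomination) (h₃ : DiagonalPullbackAlgebraic) :
    _root_.HodgeConjecture := by
  intro n X hX
  refine ⟨nonempty_hodgeModel_holds hX, ?_⟩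
  refine cyclePart_of_deepMiddle lefschetzOneOne_rational_holds
    (nonempty_hardLefschetzNFold_holds n X) hX ?_
  intro p hp2 hpn c hc hpp
  obtain ⟨A, q, c', T, hc', hpp', ⟨μ, ν, hμ, hν, e, k, hab, hk, γ, hγ, hT⟩, hTc⟩ :=
    h₂ hX p hp2 hpn c hc hpp
  have hA : IsSmoothProjective A.dim A.X := AbelianVariety.isSmoothProjective_holds
  have halg : c' ∈ algebraicClasses A.X q := (h₁ A).2 q c' hc' hpp'
  rw [← hTc, ← hT]
  exact corrClassAction_mem_algebraicClasses_of_cupProduct hX hA μ ν hν hab hk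
    (fun x y hx hy ↦ cupProduct_mem_algebraicClasses_of_forall_map_diagonal h₃
      (IsSmoothProjective.tensor_holds hX hA) _ _ hx hy) hγ halg

/-- **The crux (RankFourFaces decl, stmt-15889) from the three stubs**, BY NAME. [cite: Deligne2000, §1] -/
theorem AbelianComplement_of (h₁ : Registered.stub_hodgeAbelianVarieties)
    (h₂ : Registered.stub_abelianDomination) (h₃ : Registered.stub_diagonalPullbackAlgebraic) :
    Summit.HodgeConjecture.HodgeConjecture.Theses.RankFourFaces.AbelianComplement :=
  fun _ _ hX _ ↦ hodgeConjecture_of h₁ h₂ h₃ hX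

/-- **The crux (ConservativityLefschetz decl, stmt-10452 — the unit's keyed item) from the three stubs**, BY NAME: the
conditional form `HC_AV → HC` follows a fortiori (its antecedent is not even used). [cite: Deligne2000, §1] -/
theorem AbelianComplementCL_of (h₁ : Registered.stub_hodgeAbelianVarieties)
    (h₂ : Registered.stub_abelianDomination) (h₃ : Registered.stub_diagonalPullbackAlgebraic) :
    Summit.HodgeConjecture.HodgeConjecture.Theses.ConservativityLefschetz.AbelianComplement :=
  fun _ _ _ hX ↦ hodgeConjecture_of h₁ h₂ h₃ hX

/-- The registered form: the RankFourFaces crux from the stubs. [cite: Deligne2000, §1] -/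
theorem AbelianComplement_proof : Summit.HodgeConjecture.HodgeConjecture.Theses.RankFourFaces.AbelianComplement :=
  AbelianComplement_of stub_hodgeAbelianVarieties stub_abelianDomination stub_diagonalPullbackAlgebraic

/-! ## Consistency: (1) is a consequence of the summit and the output of the route's chain; (2) holds on abelian varieties -/

/-- `HodgeConjecture → (1)`. [cite: Deligne2000, §1] -/
theorem hodgeAbelianVarieties_of_hodgeConjecture (h : _root_.HodgeConjecture) : HodgeAbelianVarieties :=
  fun _ ↦ h AbelianVariety.isSmoothProjective_holds

/-- `RankFourWeilTransport → FaceReduction → CMToAbelian → (1)`: in route RankFourFaces stub (1) is the chain's output.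
[cite: Andre1992HodgeCM, main theorem] -/
theorem hodgeAbelianVarieties_of_chain
    (h₂ : Summit.HodgeConjecture.HodgeConjecture.Theses.RankFourFaces.RankFourWeilTransport)
    (h₃ : Summit.HodgeConjecture.HodgeConjecture.Theses.RankFourFaces.FaceReduction)
    (h₄ : Summit.HodgeConjecture.HodgeConjecture.Theses.RankFourFaces.CMToAbelian) : HodgeAbelianVarieties :=
  fun A ↦ h₄ (h₃ h₂) A AbelianVariety.isSmoothProjective_holds

/-- (2) holds on abelian varieties (identity correspondence, algebraic unconditionally). [cite: Andre1996Motifs, §2.1 (p. 14)] -/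
theorem abelianDomination_of_abelianVariety (A : AbelianVariety ℂ) (p : ℕ) (hp : 2 * p ≤ A.dim)
    (c : complexBetti A.X (2 * p)) (hc : IsRationalClass c) (hpp : IsOfHodgeType A.dim A.X (2 * p) p p c) :
    ∃ (A' : AbelianVariety ℂ) (q : ℕ) (c' : complexBetti A'.X (2 * q))
      (T : complexBetti A'.X (2 * q) →ₗ[ℂ] complexBetti A.X (2 * p)),
      IsRationalClass c' ∧ IsOfHodgeType A'.dim A'.X (2 * q) q q c' ∧
        IsAlgebraicCorrespondence A.dim A'.dim A.X A'.X T ∧ T c' = c := by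
  refine ⟨A, p, c, (complexBetti.map (𝟙 A.X) (2 * p)).hom, hc, hpp,
    isAlgebraicCorrespondence_map AbelianVariety.isSmoothProjective_holds
      AbelianVariety.isSmoothProjective_holds (𝟙 A.X) (by omega), ?_⟩
  rw [complexBetti.map_id]
  rfl

end Summit.HodgeConjecture.HodgeConjecture.Cruxes.AbelianComplement.AbelianDomination

end
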